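import Literature.AnabelianGeometry.EtaleTheta.Discharge.Sec3Example39ivFactsZTower
import Literature.AnabelianGeometry.EtaleTheta.Discharge.Sec3Example39PerfSaturationSubfunctor
import Literature.AnabelianGeometry.EtaleTheta.Discharge.Sec3Prop34iDivPlusPrinted
import Literature.AnabelianGeometry.EtaleTheta.Discharge.Sec3Remark364Weak

/-!
# [EtTh] Example 3.9 (iii) — the node: the `Φ_W^ell`-package PRODUCED at the data of record, and its «perf-factorial» clause
# at the erratum E-14 locus in BOTH vocabularies (PDF p. 84 = printed p. 310)

S. Mochizuki, *The étale theta function and its Frobenioid-theoretic manifestations*, Publ. RIMS **45** (2009)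
[cite: MochizukiEtTh2009, Ex 3.9 (iii) p.310 (PDF p.84)]: «Next, let us write `Φ_W` for the monoid on `D_W` given by forming the
perfection of the monoid “`Φ₀`” of Definition 3.3, (iii) … For `A ∈ Ob(D_W^ell)`, we take `Φ^ell_{W^ell}(A)` to be the perf-saturation [cf. §0]
in `Φ_W(A)` of the submonoid `lim→ Div⁺(Z^log_∞)^{Gal(Z^log_∞/A)} ⊆ Φ_W(A)` … Set `Φ_W^ell := Φ^ell_{W^ell}|_{D_W}` … Now observe that `Φ_W^ell`
is a perfect … and [manifestly — cf. Remark 3.6.1] group-saturated submonoid of the monoid `Φ_W` on `D_W`, which is, moreover,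
perf-factorial, non-dilating [cf. Proposition 3.4, (i) …], and cuspidally pure …».  [FrdI] Def. 2.4 (i) (perf-factorial, with
clause (d)) [cite: MochizukiFrdI2008, Def. 2.4(i) p.47].

PROOF-ONLY companion (theorems only: no `def`, no instance, no notation, no new named fact; nothing landed is edited or restated).
abc-iut cell, layer L2, cone node **EtTh:Ex3.9(iii)** (kernel id `N_EtTh_Ex3_9_iii`; statement owner abc-iut-L2-t3, `ThetaFrobenioid.lean`
p406310, where (iii) is the DATA field `Example39Data.ΦellW : SubMonoidOn T_W.Φ^ℝ` with the printed properties as the fields `isPerfect`,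
`isGroupSaturated`, `isPerfFactorial : ∀ A, V.IsPerfFactorial (Φ_W^ell(A))` — VOCABULARY-PARAMETRIC in `V : FrdIMonoidStub` — and
`isNonDilating`); seat abc-iut-w6-d046 (gen 4), holder of record per abc-iut-L2-lead R948; the lead's gloss of the residual: «perf-factorial
clause, erratum E-14 locus».  ERRATUM E-14 / cell finding F-L2d2-1 (abc-iut-L2-d2; lit register `AUTHOR-COMMENTS-ERRATA.md` row E-14, which
names Example 3.9 (iii) p. 310 l. 66–74 as a locus): [FrdI] Def. 2.4 (i)(d) FAILS for `∏_J ℤ≥0`, `J` infinite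
(`PiNat.isPerfFactorial_iff_finite`, `PerfFactorialProductCounterexample`); the cell reads §3 with the weak vocabulary of record
`treeMonoidVocabWeak` (`IsPerfFactorialCof`), the printed one being `treeMonoidVocab` (`IsPerfFactorial`).

WHAT IS PROVED (every input consumed BY NAME):
* §1 **perf-factoriality descends from the perfection** (`isPerfFactorial_of_perfection`, `isPerfFactorial_perfection_iff`): `M^pf`
  perf-factorial (printed) and `M` divisorial with monoprime components ⟹ `M` perf-factorial (clauses (c)(d) live on `M^pf ≅ (M^pf)^pf`).
* §2 **the (iii) CARRIER SHAPE at the interface**: print's `Φ^ell_{W^ell}(A)` at an object dominating the split-reduction covering is the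
  perf-saturation of `Div⁺(Z^log_∞)` inside the PERFECT `Φ_W(A)`, i.e. `≅ Div⁺(Z^log_∞)^pf` (abc-iut-L2-d2 `Lemma35.nonempty_perfection_mulEquiv_perfSaturation`).
  For every `LogDivisorModel` `Z`:  `isPerfFactorial_perfection_Divplus_iff_finite : IsPerfFactorial (Div⁺)^pf ↔ Finite (Cusp ⊔ Comp)`
  (from abc-iut-w6-d057's `isPerfFactorial_Divplus_iff_finite`), hence **`not_isPerfFactorial_perfection_Divplus_of_infinite`** (the PRINTED
  (iii)-clause «perfect … perf-factorial» is REFUTED at infinitely many special-fibre components) and **`isPerfFactorialCof_perfection_Divplus`**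
  (the REPAIRED clause HOLDS ∀ `Z`); the same for the perf-saturation of ANY `P ≅ Div⁺(Z^log_∞)` in ANY perfect monoid — print's recipe
  verbatim (`example39_iii_recipe_printed_iff_finite` / `_weak`); vocabulary forms `example39_iii_perfFactorial_printed_iff_finite` / `_weak`.
* §3 **at the typed interface `Example39Data`**: over the PRINTED vocabulary NO Example 3.9 datum has a value `Φ_W^ell(A) ≅ Div⁺(Z^log_∞)^pf`
  with infinitely many components (`Example39Data.isEmpty_mulEquiv_perfection_Divplus_of_infinite`) — the E-14 «vacuity radius» of the
  field `isPerfFactorial` in kernel at THIS node; radius bound `isPerfFactorial_perfection_Divplus_of_finite`.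
* §4 **the (iii)-package PRODUCED, binder-free, at the multi-prime data of record over the GENUINE base `B^temp(Π^tp_X)⁰`** in the repaired
  vocabulary: at abc-iut-L2-t3's `Ÿ`-skeleton with cusps (`ThetaTowerTempered.temperedFrobenioid`, p481416) the four typed (iii)-clauses are
  THEOREMS — perfect (`ThetaTowerTempered.hP`), group-saturated / perf-factorial (`IsPerfFactorialCof`; the `TemperedFrobenioid` fields, i.e.
  abc-iut's `PfImageWeak.isGroupSaturated_mrange_toRealification` / `isPerfFactorialCof_mrange_toRealification`), non-dilating along every
  endomorphism (abc-iut-f-128 `ThetaTowerTempered.isNonDilating_pull`, p486716): `ThetaTowerTempered.example39_iii_clauses`; whence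
  **`ThetaTowerTempered.nonempty_example39Data`** — `Example39Data treeMonoidVocabWeak (B^temp(Π^tp_X)⁰) T_W` is INHABITED with GENUINE (i)
  (abc-iut-w6-d059's `Example39Data.ofInducedSquare` at the identity square), (ii) read degenerately (`D^ell := D`) and (iii) := that `Φ`, NO
  hypothesis beyond the construction data `X, φ`; the ℤ-tower twin `ZTowerTempered.example39_iii_clauses` / `nonempty_example39Data`
  (abc-iut-w5-d179's `ZTowerTempered`, p463800) — the same `Example39Data` term abc-iut-w6-d047's (iv)/(v) theorems are about.
* §5 (v2, additive) **E-14 at the LITERAL (iii)-carrier of the `Ÿ`-skeleton**: `Φ₀(S) = Hom_G(S, Div⁺) ≅ Div⁺` by evaluation at a base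
  point whenever `S` is transitive and the base-point stabiliser acts trivially on `DIV` (`nonempty_phiZero_mulEquiv_Divplus_of_stabilizer`),
  hence `Φ₀(S)` is not perf-factorial as printed there (`not_isPerfFactorial_phiZero_of_stabilizer`); at the `Ÿ`-skeleton `Φ(A) ≅ Φ₀(Y_A)^pf`
  (`ThetaTowerTempered.nonempty_Φ_mulEquiv_perfection`), so **at every connected tempered covering whose stabilisers lie in `Ker φ` (the
  coverings dominating `Ÿ`) the typed `Φ_W^ell(A)` is NOT perf-factorial in `treeMonoidVocab`**
  (`ThetaTowerTempered.not_isPerfFactorial_Φ_printed_of_stabilizer_le_ker`), while it IS in `treeMonoidVocabWeak` (§4) — at φ = 1 this is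
  every object (`isPerfFactorial_vocabularies_trivialChar`): the two vocabularies DISAGREE on the typed field there.
* §6 (v4, additive) **where the vocabularies AGREE**: a weakly perf-factorial monoid with FINITELY many primes is perf-factorial as printed
  (`isPerfFactorial_of_weak_of_finite_primes` — clause (d) is automatic; E-14 never bites at finitely many primes); hence on every value
  `Φ_W^ell(A)` with finitely many primes an `Example39Data` over the weak vocabulary satisfies the PRINTED field too
  (`Example39Data.isPerfFactorial_printed_of_finite_primes`; at the `Ÿ`-skeleton `ThetaTowerTempered.isPerfFactorial_Φ_printed_of_finite_primes`).
HONEST LABEL.  (iii)'s «lim→ Div⁺ over the split-reduction sub-tower» is an INPUT at print generality (the Def. 3.3 (iii) interface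
`DivisorMonoids` has no sub-tower handle; abc-iut-w6-d061's `Sec3Example39PerfSaturationSubfunctor` gives the recipe as a subfunctor for any
input); «cuspidally pure» is Def. 3.6 (v) of the resulting tempered Frobenioid = node EtTh:Ex3.9(iv) (not a (iii) field; untouched);
«independent of the choice of tempered filter» is not typed.  The §4 data are COMBINATORIAL SKELETA read off Prop. 1.4 (not the formal scheme
`Ÿ`).  [EtTh] is refereed pre-IUT material; nothing here bears on [IUTchIII] Cor. 3.12 — no side taken; typed ≠ proved.
[claim: MochizukiEtTh2009, status: refereed pre-IUT]
-/

noncomputable section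

namespace Literature.AnabelianGeometry.EtaleTheta

open CategoryTheory Opposite Function Literature.AlgebraicGeometry.Frobenioids
  Literature.AlgebraicGeometry.Frobenioids.QuasiTemperoid Literature.AnabelianGeometry.SemiGraphs
  Literature.AlgebraicGeometry.Frobenioids.QuasiTemperoid.BTempConnected

universe u v w

/-! ### §1. Perf-factoriality (printed) descends from the perfection -/

/-- **`M^pf` perf-factorial ⟹ `M` perf-factorial** for `M` divisorial with monoprime prime components: clauses (c), (d) of [FrdI]
Def. 2.4 (i) concern `M^pf` only, and `(M^pf)^pf ≅ M^pf` (`M^pf` is perfect, §0 p. 11). [cite: MochizukiFrdI2008, Def. 2.4(i) p.47] -/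
theorem isPerfFactorial_of_perfection {M : Type w} [CommMonoid M] (h₁ : IsDivisorial M)
    (h₂ : ∀ 𝔭 : Primes M, IsMonoprime ↥𝔭.submonoid) (h : IsPerfFactorial (Perfection M)) : IsPerfFactorial M :=
  IsPerfFactorial.of_cond h₁ h₂
    (Factorization.Cond.of_mulEquiv (isPerfect_perfection (M := M)).equivPerfection.symm h.cond)

/-- **`M` perf-factorial ⟺ `M^pf` perf-factorial** (printed notion), for `M` divisorial with monoprime prime components ("one verifies
immediately that `M^pf` … [is] also perf-factorial", [FrdI] Def. 2.4 (i) p. 48, and its converse). [cite: MochizukiFrdI2008, Def. 2.4(i) p.48] -/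
theorem isPerfFactorial_perfection_iff {M : Type w} [CommMonoid M] (h₁ : IsDivisorial M)
    (h₂ : ∀ 𝔭 : Primes M, IsMonoprime ↥𝔭.submonoid) : IsPerfFactorial (Perfection M) ↔ IsPerfFactorial M :=
  ⟨isPerfFactorial_of_perfection h₁ h₂, fun h => PerfectionIsPerfFactorial_holds h⟩

/-! ### §2. The (iii) carrier shape `Div⁺(Z^log_∞)^pf` at the interface `LogDivisorModel`: printed vs repaired «perf-factorial» -/

namespace LogDivisorModel

variable (Z : LogDivisorModel.{u})

/-- **`Div⁺(Z^log_∞)^pf` is perf-factorial AS PRINTED iff the prime log-divisors are finite in number** (E-14 at the perfect carrier of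
Example 3.9 (iii)). [cite: MochizukiEtTh2009, Ex 3.9 (iii) p.310 (PDF p.84)] -/
theorem isPerfFactorial_perfection_Divplus_iff_finite :
    IsPerfFactorial (Perfection ↥Z.Divplus) ↔ Finite (Z.Cusp ⊕ Z.Comp) := by
  rw [isPerfFactorial_perfection_iff Z.isPerfFactorialWeak_Divplus.isDivisorial
    (fun 𝔭 => IsMonoprime.ofZ (Z.isZMonoprime_submonoid_primes_Divplus 𝔭))]
  exact Z.isPerfFactorial_Divplus_iff_finite

/-- **Example 3.9 (iii)'s «Φ_W^ell is a perfect … perf-factorial … submonoid» FAILS AS PRINTED at a `Z^log_∞` with infinitely many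
irreducible components of the special fibre**: `Div⁺(Z^log_∞)^pf` is not perf-factorial in the sense of [FrdI] Def. 2.4 (i) with (d).
[cite: MochizukiEtTh2009, Ex 3.9 (iii) p.310 (PDF p.84)] -/
theorem not_isPerfFactorial_perfection_Divplus_of_infinite [Infinite Z.Comp] :
    ¬ IsPerfFactorial (Perfection ↥Z.Divplus) := fun h =>
  Z.not_isPerfFactorial_Divplus_of_infinite ((isPerfFactorial_perfection_iff Z.isPerfFactorialWeak_Divplus.isDivisorial
    (fun 𝔭 => IsMonoprime.ofZ (Z.isZMonoprime_submonoid_primes_Divplus 𝔭))).mp h)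

/-- … and likewise with infinitely many cusps. [cite: MochizukiEtTh2009, Ex 3.9 (iii) p.310 (PDF p.84)] -/
theorem not_isPerfFactorial_perfection_Divplus_of_infinite_cusp [Infinite Z.Cusp] :
    ¬ IsPerfFactorial (Perfection ↥Z.Divplus) := fun h =>
  Z.not_isPerfFactorial_Divplus_of_infinite_cusp ((isPerfFactorial_perfection_iff Z.isPerfFactorialWeak_Divplus.isDivisorial
    (fun 𝔭 => IsMonoprime.ofZ (Z.isZMonoprime_submonoid_primes_Divplus 𝔭))).mp h)

/-- **RADIUS BOUND**: with finitely many cusps and components the printed clause HOLDS for `Div⁺(Z^log_∞)^pf`.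
[cite: MochizukiEtTh2009, Ex 3.9 (iii) p.310 (PDF p.84)] -/
theorem isPerfFactorial_perfection_Divplus_of_finite [Finite Z.Cusp] [Finite Z.Comp] :
    IsPerfFactorial (Perfection ↥Z.Divplus) :=
  PerfectionIsPerfFactorial_holds Z.isPerfFactorial_Divplus_of_finite

/-- **The REPAIRED clause holds for every model**: `Div⁺(Z^log_∞)^pf` is weakly perf-factorial with cofinal perfection
(`IsPerfFactorialCof`, the cell's reading of record). [cite: MochizukiEtTh2009, Ex 3.9 (iii) p.310 (PDF p.84)] -/
theorem isPerfFactorialCof_perfection_Divplus : IsPerfFactorialCof (Perfection ↥Z.Divplus) :=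
  Z.isPerfFactorialCof_Divplus.perfection

/-- **Example 3.9 (iii) «perf-factorial» in the PRINTED vocabulary `treeMonoidVocab` at the carrier `Div⁺(Z^log_∞)^pf`**: true iff
`Cusp ⊔ Comp` is finite. [cite: MochizukiEtTh2009, Ex 3.9 (iii) p.310 (PDF p.84)] -/
theorem example39_iii_perfFactorial_printed_iff_finite :
    treeMonoidVocab.IsPerfFactorial (Perfection ↥Z.Divplus) ↔ Finite (Z.Cusp ⊕ Z.Comp) := by
  rw [treeMonoidVocab_isPerfFactorial]
  exact Z.isPerfFactorial_perfection_Divplus_iff_finite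

/-- **Example 3.9 (iii) «perf-factorial» in the WEAK vocabulary of record `treeMonoidVocabWeak` at the carrier `Div⁺(Z^log_∞)^pf`**: always.
[cite: MochizukiEtTh2009, Ex 3.9 (iii) p.310 (PDF p.84)] -/
theorem example39_iii_perfFactorial_weak : treeMonoidVocabWeak.IsPerfFactorial (Perfection ↥Z.Divplus) :=
  (treeMonoidVocabWeak_isPerfFactorial _).mpr Z.isPerfFactorialCof_perfection_Divplus

/-! #### Print's recipe verbatim: the perf-saturation of `Div⁺(Z^log_∞)` inside ANY perfect ambient `Φ_W(A)` -/

variable {Q : Type u} [CommMonoid Q]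

/-- **Print's recipe «the perf-saturation in `Φ_W(A)` of `Div⁺(Z^log_∞)^{Gal}`» with `Φ_W(A)` perfect and the input `≅ Div⁺(Z^log_∞)` (split
object): the output is perf-factorial AS PRINTED iff `Cusp ⊔ Comp` is finite.** [cite: MochizukiEtTh2009, Ex 3.9 (iii) p.310 (PDF p.84)] -/
theorem example39_iii_recipe_printed_iff_finite (hQ : IsPerfect Q) {P : Submonoid Q} (e : ↥P ≃* ↥Z.Divplus) :
    treeMonoidVocab.IsPerfFactorial ↥(perfSaturation P) ↔ Finite (Z.Cusp ⊕ Z.Comp) := by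
  obtain ⟨ε⟩ := Lemma35.nonempty_perfection_mulEquiv_perfSaturation hQ P
  rw [treeMonoidVocab_isPerfFactorial, ← Z.isPerfFactorial_perfection_Divplus_iff_finite]
  exact ⟨fun h => isPerfFactorial_of_mulEquiv (ε.symm.trans (Perfection.congr e)) h,
    fun h => isPerfFactorial_of_mulEquiv ((Perfection.congr e).symm.trans ε) h⟩

/-- **… and it is perf-factorial in the WEAK vocabulary of record, for every `Z`.** [cite: MochizukiEtTh2009, Ex 3.9 (iii) p.310 (PDF p.84)] -/
theorem example39_iii_recipe_weak (hQ : IsPerfect Q) {P : Submonoid Q} (e : ↥P ≃* ↥Z.Divplus) :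
    treeMonoidVocabWeak.IsPerfFactorial ↥(perfSaturation P) :=
  (treeMonoidVocabWeak_isPerfFactorial _).mpr
    (isPerfFactorialCof_perfSaturation_of_isPerfect hQ (Z.isPerfFactorialCof_Divplus.of_mulEquiv e.symm))

end LogDivisorModel

/-- **E-14 at abc-iut-L2-t3's `Ÿ`-skeleton with cusps** (`TateTowerTheta.model`: components `ℤ`, cusps `ℤ × Bool`): `Div⁺(Ÿ)^pf` — print's
`Φ^ell_{W^ell}` at a split object — is NOT perf-factorial as printed, and IS in the weak vocabulary.
[cite: MochizukiEtTh2009, Ex 3.9 (iii) p.310 (PDF p.84)] -/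
theorem LogDivisorModel.TateTowerTheta.example39_iii_perfFactorial_verdict :
    ¬ treeMonoidVocab.IsPerfFactorial (Perfection ↥TateTowerTheta.model.Divplus) ∧
      treeMonoidVocabWeak.IsPerfFactorial (Perfection ↥TateTowerTheta.model.Divplus) := by
  haveI : Infinite TateTowerTheta.model.Comp := inferInstanceAs (Infinite ℤ)
  exact ⟨fun h => TateTowerTheta.model.not_isPerfFactorial_perfection_Divplus_of_infinite
      ((treeMonoidVocab_isPerfFactorial _).mp h), TateTowerTheta.model.example39_iii_perfFactorial_weak⟩

/-! ### §3. At the typed interface `Example39Data`: the E-14 vacuity radius of the field `isPerfFactorial` -/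

namespace Example39Data

variable {V : FrdIMonoidStub.{w}} {DW : Type u} [Category.{v} DW]

/-- **Over the PRINTED vocabulary no Example 3.9 datum has a value `Φ_W^ell(A) ≅ Div⁺(Z^log_∞)^pf` with infinitely many special-fibre
components** — the typed field `isPerfFactorial` excludes print's own carrier there (E-14 / F-L2d2-1 at the node).
[cite: MochizukiEtTh2009, Ex 3.9 (iii) p.310 (PDF p.84)] -/
theorem isEmpty_mulEquiv_perfection_Divplus_of_infinite {TW : RealifiedDivisorMonoids (D₀ := DW) treeMonoidVocab.{w}}
    (E : Example39Data treeMonoidVocab DW TW) (A : DWᵒᵖ) (Z : LogDivisorModel.{w}) [Infinite Z.Comp] :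
    IsEmpty (↥(E.ΦellW.carrier A) ≃* Perfection ↥Z.Divplus) :=
  ⟨fun e => Z.not_isPerfFactorial_perfection_Divplus_of_infinite
    (isPerfFactorial_of_mulEquiv e ((treeMonoidVocab_isPerfFactorial _).mp (E.isPerfFactorial A)))⟩

/-- **Over the WEAK vocabulary the field is no obstruction**: if `Φ_W^ell(A) ≅ Div⁺(Z^log_∞)^pf` then the typed clause holds for any `Z`
(so the models of §4 can and do realise such values). [cite: MochizukiEtTh2009, Ex 3.9 (iii) p.310 (PDF p.84)] -/
theorem isPerfFactorial_weak_of_mulEquiv_perfection_Divplus {TW : RealifiedDivisorMonoids (D₀ := DW) V}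
    (S : SubMonoidOn TW.ΦR) (A : DWᵒᵖ) (Z : LogDivisorModel.{w}) (e : ↥(S.carrier A) ≃* Perfection ↥Z.Divplus) :
    treeMonoidVocabWeak.IsPerfFactorial ↥(S.carrier A) :=
  (treeMonoidVocabWeak_isPerfFactorial _).mpr (Z.isPerfFactorialCof_perfection_Divplus.of_mulEquiv e.symm)

end Example39Data

/-! ### §4. The (iii)-package PRODUCED at the data of record over `B^temp(Π^tp_X)⁰` (weak vocabulary, binder-free) -/

namespace ThetaTowerTempered

variable {K : Type} [Field K] (X : SemiGraphs.TemperedArithmeticGroup.{0} K) (φ : X.Pi →* Multiplicative ℤ)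
  (R S : ((ConnectedPart (BTemp X.Pi))ᵒᵖ ⥤ CommMonCat.{0}) → Prop)

/-- **Example 3.9 (iii) at the `Ÿ`-skeleton with cusps, ALL FOUR typed clauses, NO hypothesis**: `Φ(A)` is perfect, group-saturated in
`Φ^{ℝ-log}(A)`, perf-factorial (weak vocabulary of record) and non-dilating along every endomorphism, at every connected tempered covering
`A` of `B^temp(Π^tp_X)⁰`. [cite: MochizukiEtTh2009, Ex 3.9 (iii) p.310 (PDF p.84)] -/
theorem example39_iii_clauses :
    (∀ A, IsPerfect ↥((temperedFrobenioid X φ R S).Φ.carrier A)) ∧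
    (∀ A, IsGroupSaturated ((temperedFrobenioid X φ R S).Φ.carrier A)) ∧
    (∀ A, treeMonoidVocabWeak.{0}.IsPerfFactorial ↥((temperedFrobenioid X φ R S).Φ.carrier A)) ∧
    (∀ (A : (ConnectedPart (BTemp X.Pi))ᵒᵖ) (f : A ⟶ A),
      treeMonoidVocabWeak.{0}.IsNonDilating ↥((temperedFrobenioid X φ R S).Φ.carrier A) ((temperedFrobenioid X φ R S).Φ.pull f)) :=
  ⟨hP X φ R S, (temperedFrobenioid X φ R S).isGroupSaturated, (temperedFrobenioid X φ R S).isPerfFactorial,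
    isNonDilating_pull X φ R S⟩

/-- **`Example39Data treeMonoidVocabWeak (B^temp(Π^tp_X)⁰) T_W` is INHABITED with (iii) := the `Ÿ`-skeleton's `Φ` and NO hypothesis**
((i) := abc-iut-w6-d059's `ofInducedSquare` at the identity square of `Π^tp_X`, (ii) := `D^ell := D`, `T_W :=` the Def. 3.6 (i) data whiskered
along the structure functor). [cite: MochizukiEtTh2009, Ex 3.9 p.309 (PDF p.83)] -/
theorem nonempty_example39Data :
    Nonempty (Example39Data treeMonoidVocabWeak.{0} (ConnectedPart (BTemp X.Pi))
      ((RealifiedDivisorMonoids.ofRlfZWeak (dm X φ) (hpf X φ)).precomp (temperedFrobenioid X φ R S).base)) :=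
  ⟨Example39Data.ofInducedSquare (MonoidHom.id X.Pi) (MonoidHom.id X.Pi) (MonoidHom.id X.Pi) (MonoidHom.id X.Pi)
    IsOpenMap.id IsOpenMap.id IsOpenMap.id IsOpenMap.id continuous_id continuous_id continuous_id continuous_id
    (fun V hV => X.isTempered.countable_quotient V hV) (fun V hV => X.isTempered.countable_quotient V hV)
    (fun V hV => X.isTempered.countable_quotient V hV) rfl treeMonoidVocabWeak.{0}
    ((RealifiedDivisorMonoids.ofRlfZWeak (dm X φ) (hpf X φ)).precomp (temperedFrobenioid X φ R S).base)
    ⊤ (ObjectProperty.topEquivalence _).inverse (ObjectProperty.topEquivalence _).symm.toAdjunction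
    ⊤ (ObjectProperty.topEquivalence _).inverse (ObjectProperty.topEquivalence _).symm.toAdjunction
    (temperedFrobenioid X φ R S).Φ (hP X φ R S) (temperedFrobenioid X φ R S).isGroupSaturated
    (temperedFrobenioid X φ R S).isPerfFactorial (isNonDilating_pull X φ R S)⟩

end ThetaTowerTempered

namespace ZTowerTempered

variable {K : Type} [Field K] (X : SemiGraphs.TemperedArithmeticGroup.{0} K) (φ : X.Pi →* Multiplicative ℤ)
  (R S : ((ConnectedPart (BTemp X.Pi))ᵒᵖ ⥤ CommMonCat.{0}) → Prop)

/-- **Example 3.9 (iii) at abc-iut-w5-d179's ℤ-tower, ALL FOUR typed clauses, NO hypothesis.**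
[cite: MochizukiEtTh2009, Ex 3.9 (iii) p.310 (PDF p.84)] -/
theorem example39_iii_clauses :
    (∀ A, IsPerfect ↥((temperedFrobenioid X φ R S).Φ.carrier A)) ∧
    (∀ A, IsGroupSaturated ((temperedFrobenioid X φ R S).Φ.carrier A)) ∧
    (∀ A, treeMonoidVocabWeak.{0}.IsPerfFactorial ↥((temperedFrobenioid X φ R S).Φ.carrier A)) ∧
    (∀ (A : (ConnectedPart (BTemp X.Pi))ᵒᵖ) (f : A ⟶ A),
      treeMonoidVocabWeak.{0}.IsNonDilating ↥((temperedFrobenioid X φ R S).Φ.carrier A) ((temperedFrobenioid X φ R S).Φ.pull f)) :=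
  ⟨hP X φ R S, (temperedFrobenioid X φ R S).isGroupSaturated, (temperedFrobenioid X φ R S).isPerfFactorial,
    isNonDilating X φ R S⟩

/-- **`Example39Data treeMonoidVocabWeak (B^temp(Π^tp_X)⁰) T_W` is INHABITED with (iii) := the ℤ-tower's `Φ` and NO hypothesis.**
[cite: MochizukiEtTh2009, Ex 3.9 p.309 (PDF p.83)] -/
theorem nonempty_example39Data :
    Nonempty (Example39Data treeMonoidVocabWeak.{0} (ConnectedPart (BTemp X.Pi))
      ((RealifiedDivisorMonoids.ofRlfZWeak (dm X φ) (hpf X φ)).precomp (temperedFrobenioid X φ R S).base)) :=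
  ⟨Example39Data.ofInducedSquare (MonoidHom.id X.Pi) (MonoidHom.id X.Pi) (MonoidHom.id X.Pi) (MonoidHom.id X.Pi)
    IsOpenMap.id IsOpenMap.id IsOpenMap.id IsOpenMap.id continuous_id continuous_id continuous_id continuous_id
    (fun V hV => X.isTempered.countable_quotient V hV) (fun V hV => X.isTempered.countable_quotient V hV)
    (fun V hV => X.isTempered.countable_quotient V hV) rfl treeMonoidVocabWeak.{0}
    ((RealifiedDivisorMonoids.ofRlfZWeak (dm X φ) (hpf X φ)).precomp (temperedFrobenioid X φ R S).base)
    ⊤ (ObjectProperty.topEquivalence _).inverse (ObjectProperty.topEquivalence _).symm.toAdjunction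
    ⊤ (ObjectProperty.topEquivalence _).inverse (ObjectProperty.topEquivalence _).symm.toAdjunction
    (temperedFrobenioid X φ R S).Φ (hP X φ R S) (temperedFrobenioid X φ R S).isGroupSaturated
    (temperedFrobenioid X φ R S).isPerfFactorial (isNonDilating X φ R S)⟩

end ZTowerTempered

/-! ### §5. E-14 at the LITERAL (iii)-carrier of the `Ÿ`-skeleton: the printed clause fails exactly at the coverings dominating `Ÿ` -/

namespace LogDivisorModel.GaloisAction

variable {Z : LogDivisorModel.{u}} {G : Type u} [Group G] (A : Z.GaloisAction G) (S : Action (Type u) G)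

/-- `(g h) · s = g · (h · s)` (structure action of a `G`-set). [folklore] -/
private theorem ρ_mul_apply (g h : G) (s : S.V) : S.ρ (g * h) s = S.ρ g (S.ρ h s) := by
  rw [map_mul]; rfl

/-- `1 · s = s`. [folklore] -/
private theorem ρ_one_apply (s : S.V) : S.ρ (1 : G) s = s := by
  rw [map_one]; rfl

/-- **`Φ₀(S) = Hom_G(S, Div⁺(Z^log_∞)) ≅ Div⁺(Z^log_∞)` by evaluation at a base point**, for a TRANSITIVE `G`-set `S` whose base-point
stabiliser acts trivially on `DIV(Z^log_∞)` (Def. 3.3 (iii): `Div⁺(Z^log_∞)^{Gal(Z^log_∞/Y)}` with `Gal(Z^log_∞/Y)` acting trivially, i.e. `Y`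
dominates `Z_∞` — for the `Ÿ`-skeleton: the coverings dominating `Ÿ`). [cite: MochizukiEtTh2009, Def 3.3 p.73] -/
theorem nonempty_phiZero_mulEquiv_Divplus_of_stabilizer (hS : isConnectedGSet S) (s₀ : S.V)
    (hstab : ∀ g : G, S.ρ g s₀ = s₀ → A.actDIV g = 1) : Nonempty (↥(A.phiZero S) ≃* ↥Z.Divplus) := by
  classical
  choose σ hσ using fun s => ((isConnectedGSet_iff S).mp hS).2 s₀ s
  have hwd : ∀ g g' : G, S.ρ g s₀ = S.ρ g' s₀ → A.actDIV g = A.actDIV g' := by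
    intro g g' h
    have hfix : S.ρ (g'⁻¹ * g) s₀ = s₀ := by
      rw [ρ_mul_apply, h, ← ρ_mul_apply, inv_mul_cancel, ρ_one_apply]
    have h1 := hstab _ hfix
    rwa [map_mul, map_inv, inv_mul_eq_one, eq_comm] at h1
  refine ⟨{ toFun := fun f => ⟨f.1 s₀, f.2.1 s₀⟩
            invFun := fun d => ⟨fun s => A.actDIV (σ s) d,
              fun s => ⟨A.act_mem_Div _ d.2.1, A.act_mem_DIVplus _ d.2.2⟩, fun g s => ?_⟩
            left_inv := fun f => Subtype.ext (funext fun s => ?_)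
            right_inv := fun d => Subtype.ext ?_
            map_mul' := fun _ _ => rfl }⟩
  · change A.actDIV (σ (S.ρ g s)) (d : Z.DIV) = A.actDIV g (A.actDIV (σ s) d)
    rw [hwd (σ (S.ρ g s)) (g * σ s) (by rw [hσ, ρ_mul_apply, hσ]), map_mul, MulAut.mul_apply]
  · change A.actDIV (σ s) (f.1 s₀) = f.1 s
    rw [← f.2.2 (σ s) s₀, hσ]
  · change A.actDIV (σ s₀) (d : Z.DIV) = d
    rw [hwd (σ s₀) 1 (by rw [hσ, ρ_one_apply]), map_one, MulAut.one_apply]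

/-- Hence **`Φ₀(S)` is NOT perf-factorial as printed** at such `S` whenever the special fibre of `Z^log_∞` has infinitely many irreducible
components (E-14 at Def. 3.3 (iii)'s own pieces), while it IS in the weak vocabulary (`prop34_i_phiZero`, abc-iut-w6-d057).
[cite: MochizukiEtTh2009, Prop 3.4 p.74] -/
theorem not_isPerfFactorial_phiZero_of_stabilizer [Infinite Z.Comp] (hS : isConnectedGSet S) (s₀ : S.V)
    (hstab : ∀ g : G, S.ρ g s₀ = s₀ → A.actDIV g = 1) : ¬ IsPerfFactorial ↥(A.phiZero S) := fun h => by
  obtain ⟨e⟩ := A.nonempty_phiZero_mulEquiv_Divplus_of_stabilizer S hS s₀ hstab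
  exact Z.not_isPerfFactorial_Divplus_of_infinite (isPerfFactorial_of_mulEquiv e h)

end LogDivisorModel.GaloisAction

namespace ThetaTowerTempered

variable {K : Type} [Field K] (X : SemiGraphs.TemperedArithmeticGroup.{0} K) (φ : X.Pi →* Multiplicative ℤ)
  (R S : ((ConnectedPart (BTemp X.Pi))ᵒᵖ ⥤ CommMonCat.{0}) → Prop)

/-- `Φ(A) ≅ Φ₀(Y_A)^pf` at the `Ÿ`-skeleton (`Φ := im(Φ₀^pf → Φ₀^rlf)` and `Φ₀^pf → Φ₀^rlf` is injective, [FrdI] Def. 2.4 (i)(c)).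
[cite: MochizukiEtTh2009, Def 3.6 p.76] -/
theorem nonempty_Φ_mulEquiv_perfection (A : (ConnectedPart (BTemp X.Pi))ᵒᵖ) :
    Nonempty (↥((temperedFrobenioid X φ R S).Φ.carrier A) ≃*
      Perfection ((dm X φ).Φ₀.obj (op ((OneCompTempered.equiv X).inverse.obj A.unop)))) :=
  ⟨(MulEquiv.ofBijective _ (PfImageWeak.mrangeRestrict_toRealification_bijective
    (hpf X φ (op ((OneCompTempered.equiv X).inverse.obj A.unop))).weak)).symm⟩

/-- **E-14 at the LITERAL Example 3.9 (iii) carrier of the `Ÿ`-skeleton with cusps**: at every connected tempered covering `A` of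
`B^temp(Π^tp_X)⁰` whose stabilisers lie in `Ker φ` (the coverings DOMINATING `Ÿ`: there `Φ₀(Y_A) = Div⁺(Ÿ)`, components indexed by `ℤ`),
`Φ_W^ell(A) = Φ(A)` is NOT perf-factorial in the PRINTED sense ([FrdI] Def. 2.4 (i) with (d)) — although it IS in the weak vocabulary of
record (`example39_iii_clauses`). [cite: MochizukiEtTh2009, Ex 3.9 (iii) p.310 (PDF p.84)] -/
theorem not_isPerfFactorial_Φ_printed_of_stabilizer_le_ker (A : (ConnectedPart (BTemp X.Pi))ᵒᵖ) (s₀ : (gset X A.unop).V)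
    (hφ : ∀ g : X.Pi, (gset X A.unop).ρ g s₀ = s₀ → φ g = 1) :
    ¬ treeMonoidVocab.{0}.IsPerfFactorial ↥((temperedFrobenioid X φ R S).Φ.carrier A) := by
  intro h
  rw [treeMonoidVocab_isPerfFactorial] at h
  obtain ⟨e₁⟩ := nonempty_Φ_mulEquiv_perfection X φ R S A
  have hw := (hpf X φ (op ((OneCompTempered.equiv X).inverse.obj A.unop))).weak
  have h₁ : IsPerfFactorial ((dm X φ).Φ₀.obj (op ((OneCompTempered.equiv X).inverse.obj A.unop))) :=
    isPerfFactorial_of_perfection hw.isDivisorial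
      (fun 𝔭 => IsMonoprime.ofZ (LogDivisorModel.GaloisAction.isZMonoprime_submonoid_primes_phiZero
        (LogDivisorModel.TateTowerTheta.action φ) (gset X A.unop) 𝔭))
      (isPerfFactorial_of_mulEquiv e₁ h)
  haveI : Infinite LogDivisorModel.TateTowerTheta.model.Comp := inferInstanceAs (Infinite ℤ)
  exact LogDivisorModel.GaloisAction.not_isPerfFactorial_phiZero_of_stabilizer (LogDivisorModel.TateTowerTheta.action φ) (gset X A.unop)
    (isConnectedGSet_gset X A.unop) s₀
    (fun g hg => by rw [LogDivisorModel.TateTowerTheta.action, LogDivisorModel.GaloisAction.comap_actDIV, hφ g hg, map_one]) h₁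

/-- **In particular at the TRIVIAL character** (the reading in which every covering dominates `Ÿ`): the printed (iii)-clause FAILS at EVERY
object, the weak one HOLDS at every object — the two vocabularies DISAGREE on the typed field `isPerfFactorial` for this `Φ_W^ell`.
[cite: MochizukiEtTh2009, Ex 3.9 (iii) p.310 (PDF p.84)] -/
theorem isPerfFactorial_vocabularies_trivialChar (A : (ConnectedPart (BTemp X.Pi))ᵒᵖ) :
    ¬ treeMonoidVocab.{0}.IsPerfFactorial ↥((temperedFrobenioid X 1 R S).Φ.carrier A) ∧
      treeMonoidVocabWeak.{0}.IsPerfFactorial ↥((temperedFrobenioid X 1 R S).Φ.carrier A) :=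
  ⟨not_isPerfFactorial_Φ_printed_of_stabilizer_le_ker X 1 R S A (nonempty_gset X A.unop).some fun _ _ => rfl,
    (temperedFrobenioid X 1 R S).isPerfFactorial A⟩

end ThetaTowerTempered

/-! ### §6. Where the two vocabularies AGREE on the typed field: finitely many primes (the E-14 radius, abstractly) -/

/-- **A weakly perf-factorial monoid with finitely many primes is perf-factorial AS PRINTED** — clause (d) of [FrdI] Def. 2.4 (i) is automatic
when `Prime(M) ≅ Prime(M^pf)` is finite (every support is finite): E-14 never bites at finitely many primes. [cite: MochizukiFrdI2008, Def. 2.4(i) p.47] -/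
theorem isPerfFactorial_of_weak_of_finite_primes {M : Type w} [CommMonoid M] (h : IsPerfFactorialWeak M) [Finite (Primes M)] :
    IsPerfFactorial M := by
  obtain ⟨e, -⟩ := primes_equiv_primes_perfection h.isDivisorial.isSharp
  haveI : Finite (Primes (Perfection M)) := Finite.of_equiv _ e
  exact h.isPerfFactorial_of_supp_finite fun _ => Set.toFinite _

/-- **At the typed interface: on every value `Φ_W^ell(A)` with FINITELY MANY primes the printed and the repaired reading of the (iii) field
`isPerfFactorial` AGREE** (contrast §3/§5: they disagree at `Div⁺(Z^log_∞)^pf` with infinitely many components). [cite: MochizukiEtTh2009, Ex 3.9 (iii) p.310 (PDF p.84)] -/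
theorem Example39Data.isPerfFactorial_printed_of_finite_primes {DW : Type u} [Category.{v} DW]
    {TW : RealifiedDivisorMonoids (D₀ := DW) treeMonoidVocabWeak.{w}} (E : Example39Data treeMonoidVocabWeak DW TW) (A : DWᵒᵖ)
    [Finite (Primes ↥(E.ΦellW.carrier A))] : treeMonoidVocab.IsPerfFactorial ↥(E.ΦellW.carrier A) :=
  (treeMonoidVocab_isPerfFactorial _).mpr
    (isPerfFactorial_of_weak_of_finite_primes ((treeMonoidVocabWeak_isPerfFactorial _).mp (E.isPerfFactorial A)).weak)

namespace ThetaTowerTempered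

variable {K : Type} [Field K] (X : SemiGraphs.TemperedArithmeticGroup.{0} K) (φ : X.Pi →* Multiplicative ℤ)
  (R S : ((ConnectedPart (BTemp X.Pi))ᵒᵖ ⥤ CommMonCat.{0}) → Prop)

/-- **At the `Ÿ`-skeleton: wherever `Φ(A)` has finitely many primes (finitely many Galois orbits of prime log-divisors, Rmk. 3.3.1) the
PRINTED (iii)-clause HOLDS** (complement of §5's `not_isPerfFactorial_Φ_printed_of_stabilizer_le_ker`). [cite: MochizukiEtTh2009, Ex 3.9 (iii) p.310 (PDF p.84)] -/
theorem isPerfFactorial_Φ_printed_of_finite_primes (A : (ConnectedPart (BTemp X.Pi))ᵒᵖ)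
    [Finite (Primes ↥((temperedFrobenioid X φ R S).Φ.carrier A))] :
    treeMonoidVocab.{0}.IsPerfFactorial ↥((temperedFrobenioid X φ R S).Φ.carrier A) :=
  (treeMonoidVocab_isPerfFactorial _).mpr
    (isPerfFactorial_of_weak_of_finite_primes
      ((treeMonoidVocabWeak_isPerfFactorial _).mp ((temperedFrobenioid X φ R S).isPerfFactorial A)).weak)

end ThetaTowerTempered

end Literature.AnabelianGeometry.EtaleTheta
end
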